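import Summits.HodgeConjecture.HodgeConjecture.Theses.HeckePrymWeil
import Summits.HodgeConjecture.HodgeConjecture.Theses.HeckeOrbitCompactness
import Literature.Barriers.HodgeConjecture.ExceptionalHodgeClasses
import Literature.AlgebraicGeometry.HodgeTheory.LefschetzOneOne

/-!
# Sketch — crux-ideate round 1 (ideator 1) for `WeilTenfoldsSqrtMinus11` (stmt-HodgeConjecture-1262)

First-lemma signatures of the two crux idea cards filed from this seat:

* card `quaternionic-norm-anchors`: `CyclotomicNormAnchor` (the crux restricted to the
  quaternionic / cyclotomic anchor locus, where the ℚ(√-11)-Weil plane is a NORM of divisor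
  classes), its linear-algebra core `NormIdentity`, and the arithmetic purity stub
  `GaussPeriodDesign` (Chern-character purity of a ψ-symmetric presentation = a design over
  `ℚ(ζ₁₁)`).
* card `quaternionic-orbit-compactness`: `QMOrbitDegreeBound` (uniform divisor-degree bound along
  the ℚ(√-11)-isogeny orbit of a cyclotomic seed) and `QMOrbitGlue` (Chow compactness + orbit
  density carry it to the crux).

Nothing here is proved; everything must elaborate (`lean check` rc 0, no `sorry`).
-/

noncomputable section

open CategoryTheory Literature.AlgebraicGeometry Literature.AlgebraicGeometry.HodgeTheory

namespace Summit.HodgeConjecture.HodgeConjecture.Cruxes.WeilTenfoldsSqrtMinus11.SketchIdeatorOne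

open Summit.HodgeConjecture.HodgeConjecture.Theses.HeckePrymWeil

/-- The `σ`-Weil eigenline of the crux: `Eig((𝟙+φ)^* on H¹⁰, (1+i√11)¹⁰)`. -/
abbrev weilPlus (A : Motives.AbelianVariety ℂ) (φ : A ⟶ A) : Submodule ℂ (complexBetti A.X 10) :=
  Module.End.eigenspace (complexBetti.map (CategoryStruct.id A + φ).hom.hom.hom 10).hom
    ((1 + Complex.I * (Real.sqrt (11 : ℝ) : ℂ)) ^ 10)

/-- The `σ̄`-Weil eigenline of the crux: `Eig((𝟙+φ)^* on H¹⁰, (1-i√11)¹⁰)`. -/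
abbrev weilMinus (A : Motives.AbelianVariety ℂ) (φ : A ⟶ A) : Submodule ℂ (complexBetti A.X 10) :=
  Module.End.eigenspace (complexBetti.map (CategoryStruct.id A + φ).hom.hom.hom 10).hom
    ((1 - Complex.I * (Real.sqrt (11 : ℝ) : ℂ)) ^ 10)

/-- Eleven-fold composite of an endomorphism (`ψ¹¹`), written with `≫` only. -/
abbrev pow11 {A : Motives.AbelianVariety ℂ} (ψ : A ⟶ A) : A ⟶ A :=
  ψ ≫ ψ ≫ ψ ≫ ψ ≫ ψ ≫ ψ ≫ ψ ≫ ψ ≫ ψ ≫ ψ ≫ ψ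

/-- The quadratic Gauss sum in an order-11 endomorphism `ψ`:
`g(ψ) = Σ_{a=1}^{10} (a|11) ψᵃ`, squares mod 11 = {1,3,4,5,9}; `g(ψ)² = -11` when `Φ₁₁(ψ) = 0`. -/
abbrev gaussSum {A : Motives.AbelianVariety ℂ} (ψ : A ⟶ A) : A ⟶ A :=
  (ψ + ψ ≫ ψ ≫ ψ + ψ ≫ ψ ≫ ψ ≫ ψ + ψ ≫ ψ ≫ ψ ≫ ψ ≫ ψ + ψ ≫ ψ ≫ ψ ≫ ψ ≫ ψ ≫ ψ ≫ ψ ≫ ψ ≫ ψ)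
  - (ψ ≫ ψ + ψ ≫ ψ ≫ ψ ≫ ψ ≫ ψ ≫ ψ + ψ ≫ ψ ≫ ψ ≫ ψ ≫ ψ ≫ ψ ≫ ψ
      + ψ ≫ ψ ≫ ψ ≫ ψ ≫ ψ ≫ ψ ≫ ψ ≫ ψ + ψ ≫ ψ ≫ ψ ≫ ψ ≫ ψ ≫ ψ ≫ ψ ≫ ψ ≫ ψ ≫ ψ)

/-- **Signature (1,1) at every place of ℚ(ζ₁₁)**, typed through pull-backs only: for every
primitive 11th root of unity `u`, the `(1+u)²`-eigenclasses of `(𝟙+ψ)^*` on `H²(A(ℂ);ℂ)` — given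
`H² = ∧²H¹` this is exactly the line `∧²U_u`, `U_u` the `u`-eigenspace of `ψ^*` on `H¹` (the mixed
summands `U_v ⊗ U_w`, `vw = u²`, `v ≠ w`, have eigenvalue `(1+v)(1+w) ≠ (1+u)²`) — lie in the
`ℂ`-span of products of ONE rational `(1,1)`-class, i.e. are divisorial (`divisorClassesSpan`, barrier
file `ExceptionalHodgeClasses`). Equivalent to `dim U_u^{1,0} = dim U_u^{0,1} = 1` for all `u`
(quaternionic multiplication by `D ⊇ ℚ(ζ₁₁)` over `ℚ(ζ₁₁)⁺`, Shimura's degenerate type-IV case). -/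
def SignatureOneOne (A : Motives.AbelianVariety ℂ) (ψ : A ⟶ A) : Prop :=
  ∀ u : ℂ, u ^ 11 = 1 → u ≠ 1 →
    Module.End.eigenspace (complexBetti.map (CategoryStruct.id A + ψ).hom.hom.hom 2).hom ((1 + u) ^ 2)
      ≤ Literature.Barriers.HodgeConjecture.divisorClassesSpan A.X 10 1

/-- **Card `quaternionic-norm-anchors`, FIRST LEMMA (anchor theorem).** On an abelian tenfold
`A` carrying an automorphism `ψ` of order 11 (`ψ¹¹ = 𝟙`, `ψ ≠ 𝟙`; then `Φ₁₁(ψ) = 0` on `H¹` as soon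
as `1` is not an eigenvalue, which `SignatureOneOne` forces) of signature `(1,1)` at every place,
with `φ = g(ψ)` the quadratic Gauss sum (so `φ² = -11`, `K = ℚ(√-11) ⊂ L = ℚ(ζ₁₁)`), the crux's
conclusion holds: every rational `(5,5)`-class of the ℚ(√-11)-Weil plane is algebraic — because
`∧¹⁰U_σ = ⊗_{a ∈ □} ∧²U_{ζᵃ}` is a cup product of five divisorial lines (`NormIdentity`) and divisor
monomials are algebraic (Lefschetz (1,1) + `AbelianVariety.cupProduct_mem_algebraicClasses_one`).
These anchors form 5-dimensional compact Shimura subvarieties in EVERY discriminant component of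
the ℚ(√-11)-Weil tenfold locus. -/
def CyclotomicNormAnchor : Prop :=
  ∀ (A : Motives.AbelianVariety ℂ) (φ ψ : A ⟶ A), A.dim = 10 →
    pow11 ψ = CategoryStruct.id A → ψ ≠ CategoryStruct.id A → φ = gaussSum ψ →
    SignatureOneOne A ψ →
    CategoryStruct.comp φ φ = -((11 : ℤ) • CategoryStruct.id A) →
    ∀ c : complexBetti A.X 10, IsRationalClass c → IsOfHodgeType 10 A.X 10 5 5 c →
      c ∈ weilPlus A φ ⊔ weilMinus A φ → c ∈ algebraicClasses A.X 5

/-- **The norm identity (linear-algebra core of the anchor theorem).** Under the same hypotheses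
the two Weil eigenlines lie in the `ℂ`-span of 5-fold cup products of rational `(1,1)`-classes:
`W_K ⊗ ℂ = N_{L/K}(∧²_L H¹) ⊆ D⁵ ⊗ ℂ`. Needs `H^•(A(ℂ)) = ∧^•H¹` (not in tree) and the eigenvalue
bookkeeping `(1+ζᵃ)(1+ζᵇ) = (1+ζᶜ)² ⇒ a = b` / `∏_{a∈□}(1+ζᵃ)² = (1+i√11)¹⁰`-type identities
(sibling Disproof: `weilAB 11`, `mixed_eigenvalue_ne_pos_ten`). -/
def NormIdentity : Prop :=
  ∀ (A : Motives.AbelianVariety ℂ) (φ ψ : A ⟶ A), A.dim = 10 →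
    pow11 ψ = CategoryStruct.id A → ψ ≠ CategoryStruct.id A → φ = gaussSum ψ →
    SignatureOneOne A ψ →
    weilPlus A φ ⊔ weilMinus A φ ≤ Literature.Barriers.HodgeConjecture.divisorClassesSpan A.X 10 5

/-- Sanity: the anchor theorem is an instance-shape of the crux (the crux implies it by dropping
the `ψ`-hypotheses), so a proof of `CyclotomicNormAnchor` is genuinely weaker than the crux and a
refutation of it would refute the crux. -/
theorem cyclotomicNormAnchor_of_crux (h : WeilTenfoldsSqrtMinus11) : CyclotomicNormAnchor :=
  fun A φ _ψ hd _ _ _ _ hφ c hr hh he => h A φ hd hφ c hr hh he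

/-! ### The purity design over `ℚ(ζ₁₁)` (second stub of card `quaternionic-norm-anchors`)

At an anchor, `NS(A) ⊗ ℚ ⊇ μ(L)`, `L = ℚ(ζ₁₁)`, with `μ(λ) = Σ_a σ_a(λ) ε_a` (`ε_a` a generator of the
divisorial line `∧²U_{ζᵃ}`, `ε_a² = 0`), so a presentation `E` glued from line bundles / semi-homogeneous
bundles with `c₁ = n_t θ + μ(λ_t)` has `ch(E) = Σ_t s_t e^{n_t θ} ∏_a (1 + σ_a(λ_t) ε_a)`; it stays
Hodge along the whole 25-dimensional Weil component iff every coefficient of `θ^k ε_S` vanishes for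
`S ⊄ {∅, □, ⊠, all}` — a DESIGN condition on `(s_t, n_t, λ_t)`; for `ψ`-invariant `E` only the 90
zero-sum `S` (12 Galois orbits) remain, and among the 32 transversal ("CM-type") monomials exactly
`□` and `⊠` are zero-sum. The statement below is the bare purity design with `θ`-levels. -/

/-- `ζ₁₁ = exp(2πi/11) ∈ ℂ`. -/
abbrev zeta11 : ℂ := Complex.exp (2 * Real.pi * Complex.I / 11)

/-- The embedding `σ_a : ℚ(ζ₁₁) → ℂ`, `ζ ↦ ζᵃ`, on an element given by its rational coordinates
`q` in the power basis `1, ζ, …, ζ⁹`: `σ_a(Σ_j q_j ζʲ) = Σ_j q_j ζ^{aj}`. -/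
abbrev embed (q : Fin 10 → ℚ) (a : ZMod 11) : ℂ :=
  ∑ j : Fin 10, (q j : ℂ) * zeta11 ^ (a.val * (j : ℕ))

/-- The squares of `(ℤ/11)ˣ` = `{1,3,4,5,9}` = the embeddings restricting to `σ` on `K = ℚ(√-11)`
(`Gal(ℚ(ζ₁₁)/K)` = squares), as a finset of units. -/
abbrev squares11 : Finset (ZMod 11)ˣ := Finset.univ.filter fun a => IsSquare a

/-- **GaussPeriodDesign r**: there are `r` terms `(s_t ∈ ℤ, n_t ∈ ℤ, λ_t ∈ ℚ(ζ₁₁))` (each `λ_t`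
given by rational coordinates) whose weighted partial norms `Σ_t s_t n_tᵏ ∏_{a ∈ S} σ_a(λ_t)`
vanish for every set `S` of embeddings other than `∅`, the squares `□`, the non-squares `⊠` and all
ten, in every `θ`-degree `k` with `k + |S| ≤ 10`, while the `□`-partial norm (the coefficient of
the `σ`-Weil class `ε_□`) is non-zero. True for large `r` by a span argument (Galois-equivariant
targets lie in the `ℚ`-span of partial-norm vectors); the line needs it with `r` small and with an
index pattern making the presentation Ext¹-connected and semiregular (card: Cheapest falsifier). -/
def GaussPeriodDesign (r : ℕ) : Prop :=
  ∃ (s n : Fin r → ℤ) (q : Fin r → Fin 10 → ℚ),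
    (∀ S : Finset (ZMod 11)ˣ, S.Nonempty → S ≠ Finset.univ → S ≠ squares11 → S ≠ squares11ᶜ →
      ∀ k : ℕ, k + S.card ≤ 10 →
        ∑ t, (s t : ℂ) * (n t : ℂ) ^ k * ∏ a ∈ S, embed (q t) (a : ZMod 11) = 0) ∧
    ∑ t, (s t : ℂ) * ∏ a ∈ squares11, embed (q t) (a : ZMod 11) ≠ 0

/-! ### Card `quaternionic-orbit-compactness` -/

/-- **QMOrbitDegreeBound** (first lemma of card `quaternionic-orbit-compactness`): for every
cyclotomic seed `(A₀, φ₀ = g(ψ₀), ψ₀)` as in `CyclotomicNormAnchor` and every polarization degree `t`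
there is ONE integer `M` such that on every abelian tenfold `A` reached from `A₀` by a
ℚ(√-11)-equivariant isogeny `g` (this sweeps the Hecke orbit of the anchor, dense in the anchor's
discriminant component — and every discriminant class of ℚ(√-11)-Weil tenfolds contains such seeds),
every rational class of the Weil plane is supported on a proper intersection `D₁ ∩ ⋯ ∩ D₅` of
effective `Dᵢ ∈ |kᵢ P|`, `kᵢ ≤ M`. At `A = A₀` (g = 𝟙) this is the anchor theorem made effective
(divisor-norm representatives); along the orbit it is the two-sided arithmetic question of the card. -/
def QMOrbitDegreeBound : Prop :=
  ∀ (A₀ : Motives.AbelianVariety ℂ) (φ₀ ψ₀ : A₀ ⟶ A₀), A₀.dim = 10 →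
    pow11 ψ₀ = CategoryStruct.id A₀ → ψ₀ ≠ CategoryStruct.id A₀ → φ₀ = gaussSum ψ₀ →
    SignatureOneOne A₀ ψ₀ →
    ∀ t : ℕ, ∃ M : ℕ, ∀ (A : Motives.AbelianVariety ℂ) (g : A₀ ⟶ A) (φ : A ⟶ A)
      (P : Motives.CartierDivisor A.X.left)
      [AlgebraicGeometry.IsDominant (Motives.AbelianVariety.Hom.toSchemeHom g)],
      Motives.AbelianVariety.IsIsogeny g → A.dim = 10 →
      CategoryStruct.comp φ₀ g = CategoryStruct.comp g φ →
      CategoryStruct.comp φ φ = -((11 : ℤ) • CategoryStruct.id A) →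
      P.IsAmple → P.IsSection 1 → P.h0 ℂ = t →
      ∀ c : complexBetti A.X 10, IsRationalClass c → c ∈ weilPlus A φ ⊔ weilMinus A φ →
        c ∈ ⨆ (D : Fin 5 → Motives.CartierDivisor A.X.left)
            (_ : ∀ i, (D i).IsSection 1 ∧ ∃ k : ℕ, k ≤ M ∧ (D i).LinEquiv (k • P))
            (_ : ∀ z ∈ {z | ∀ i, ¬ (D i).Avoids z}, ((5 : ℕ) : ℕ∞) ≤ Order.coheight z),
            LinearMap.ker (complexBetti.restrictCompl A.X {z | ∀ i, ¬ (D i).Avoids z} 10).hom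

/-- **QMOrbitGlue**: Chow compactness (bounded-degree effective supports form proper relative Chow
schemes, so the locus where a flat class is so supported is Zariski closed), density of the
ℚ(√-11)-Hecke orbit of each quaternionic seed in its discriminant component, and the existence of
seeds in every component turn the orbit bound into the crux. (Informal content not in tree:
relative Chow schemes over the Weil-type Shimura variety, Hecke density, discriminant census.) -/
def QMOrbitGlue : Prop :=
  QMOrbitDegreeBound → WeilTenfoldsSqrtMinus11

end Summit.HodgeConjecture.HodgeConjecture.Cruxes.WeilTenfoldsSqrtMinus11.SketchIdeatorOne

end
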